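import Mathlib
import HarnessLib
import Literature.Analysis.InverseSpectral.StieltjesInversion
import Literature.Analysis.InverseSpectral.StieltjesHolomorphic
import Literature.Analysis.InverseSpectral.StieltjesDataUnique
import Literature.Analysis.FunctionSpaces.HellySelectionProofs
import Literature.Analysis.FunctionSpaces.DiagonalWeakLimits
import Summits.AtomisticToContinuum.FouriersLaw.Theses.ContactStieltjesMeasure

/-!
# Sketch (crux-ideate, ideator 1, round 1; v3) — crux `ContactMeasureLimit` (stmt-AtomisticToContinuum-15250)

Idea `escaped-mass-stieltjes-constant`: the analysis half of (M) — the Stieltjes continuity theorem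
for the contact kernel `k_γ(t) = 2t/(γ²+t²)²`, i.e. the registered stub `stub_stieltjesContinuity` of
BOTH lines `birth` and `escape-import` and child 1 of the staged split — is GLUE over theorems that
are already in the tree, once the problem is phrased in the squared variable `λ = s²`.

State of this file (`lean check` rc 0): PROVED sorry-free —
* `apriori_local_bound` (one-friction local bound; `∫_a^∞ k_γ = (γ²+a²)⁻¹`),
* `helly_local` (Helly with local bounds, over the tree's diagonal extraction at the rationals),
* `hasStieltjesRepresentation_contactCS` (the DICTIONARY into the tree's class `N_S`, from `layer_cake`),
* `limitData_unique` (UNIQUENESS of the limit data, over the tree's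
  `eqOn_of_hasStieltjesRepresentation_of_eqOn_neg` + `stieltjes_data_unique`),
* `eq_at_continuity_of_sqContactMeasure_eq` (equal squared measures ⇒ equal values at continuity points);
SORRY (prover work, pure 1-D real analysis) —
* `layer_cake` : `∫ (γ²+s²)⁻¹ dμ_F(s) = ∫₀^∞ F k_γ` (Tonelli on `k_γ(t)·1{s ≤ t}`, `rightLim F = F` a.e.),
* `limitData_of_subseq` : along a Helly subsequence the transforms' limit has Stieltjes data `(e, ν_G)`,
  the constant `e ≥ 0` being the ESCAPED (UV) contact mass (bounded convergence on `[0,R]`, Fatou,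
  kernel-ratio `→ 1` tail estimate; pattern: `StieltjesDataUnique.tendsto_apply_neg_atTop`).
With these, `StieltjesContinuity` (stated verbatim at the end) follows by the sub-subsequence principle.
-/

noncomputable section

namespace Summit.AtomisticToContinuum.FouriersLaw.Cruxes.ContactMeasureLimit.IdeatorOne

open MeasureTheory Filter Set Topology Function
open Literature.Analysis.InverseSpectral

/-! ## Objects -/

/-- The contact kernel `k_γ(t) = 2t/(γ²+t²)² = -∂_t (γ²+t²)⁻¹`. -/
def contactKernel (γ t : ℝ) : ℝ := 2 * t / (γ ^ 2 + t ^ 2) ^ 2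

/-- The contact transform `∫₀^∞ F(t) k_γ(t) dt` of a distribution function `F`
(in the route: `D_N(γ) = (N-1)·γ·contactTransform Φ_N γ`). -/
def contactTransform (F : ℝ → ℝ) (γ : ℝ) : ℝ :=
  ∫ t in Ioi (0 : ℝ), F t * contactKernel γ t

/-- The structural hypothesis of the crux on one `Φ_N`: monotone, zero on `(-∞,0]`, bounded above
(an `abbrev`, so that projections `hF.1` stay transparent to `rw`). -/
abbrev IsContactDF (F : ℝ → ℝ) : Prop :=
  Monotone F ∧ (∀ s : ℝ, s ≤ 0 → F s = 0) ∧ ∃ m : ℝ, ∀ s : ℝ, F s ≤ m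

/-- The contact measure of a monotone `F` in the SQUARED variable `λ = s²`: the Lebesgue–Stieltjes
measure of the right-continuous modification `rightLim F` (Mathlib `Monotone.stieltjesFunction`),
pushed forward by `s ↦ s²`. -/
def sqContactMeasure {F : ℝ → ℝ} (hF : Monotone F) : Measure ℝ :=
  (hF.stieltjesFunction.measure).map fun s : ℝ => s ^ 2

/-- The Cauchy–Stieltjes extension of the contact transform to the cut plane `ℂ ∖ [0,∞)`:
`z ↦ ∫ dν_F(λ)/(λ - z)`. -/
def contactCS {F : ℝ → ℝ} (hF : Monotone F) (z : ℂ) : ℂ :=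
  ∫ t, ((t : ℂ) - z)⁻¹ ∂(sqContactMeasure hF)

/-! ## 1. A priori local bound from one friction (PROVED) -/

/-- `-(γ²+x²)⁻¹` is a primitive of the contact kernel. -/
lemma hasDerivAt_negInv (γ : ℝ) (hγ : 0 < γ) (s : ℝ) :
    HasDerivAt (fun x : ℝ => -(γ ^ 2 + x ^ 2)⁻¹) (contactKernel γ s) s := by
  have hpos : 0 < γ ^ 2 + s ^ 2 := by positivity
  have h1 : HasDerivAt (fun x : ℝ => γ ^ 2 + x ^ 2) (2 * s) s := by
    simpa using ((hasDerivAt_pow 2 s).const_add (γ ^ 2))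
  have h2 := (h1.inv hpos.ne').neg
  refine h2.congr_deriv ?_
  unfold contactKernel
  rw [neg_div, neg_neg]

lemma contactKernel_nonneg (γ : ℝ) {s : ℝ} (hs : 0 ≤ s) : 0 ≤ contactKernel γ s := by
  unfold contactKernel; positivity

lemma tendsto_negInv (γ : ℝ) : Tendsto (fun x : ℝ => -(γ ^ 2 + x ^ 2)⁻¹) atTop (𝓝 0) := by
  have h : Tendsto (fun x : ℝ => γ ^ 2 + x ^ 2) atTop atTop :=
    tendsto_atTop_add_const_left _ _ (tendsto_pow_atTop two_ne_zero)
  simpa using (tendsto_inv_atTop_zero.comp h).neg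

lemma continuous_negInv (γ : ℝ) (hγ : 0 < γ) : Continuous (fun x : ℝ => -(γ ^ 2 + x ^ 2)⁻¹) := by
  refine Continuous.neg (Continuous.inv₀ (by fun_prop) (fun x => ?_))
  positivity

/-- `k_γ` is integrable on `(a, ∞)` and `∫_a^∞ k_γ = (γ² + a²)⁻¹` (`a ≥ 0`): the layer-cake key. -/
lemma integral_Ioi_contactKernel (γ : ℝ) (hγ : 0 < γ) {a : ℝ} (ha : 0 ≤ a) :
    IntegrableOn (contactKernel γ) (Ioi a) ∧
      ∫ s in Ioi a, contactKernel γ s = (γ ^ 2 + a ^ 2)⁻¹ := by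
  have hcont : ContinuousWithinAt (fun x : ℝ => -(γ ^ 2 + x ^ 2)⁻¹) (Ici a) a :=
    (continuous_negInv γ hγ).continuousWithinAt
  have hderiv : ∀ x ∈ Ioi a,
      HasDerivAt (fun x : ℝ => -(γ ^ 2 + x ^ 2)⁻¹) (contactKernel γ x) x :=
    fun x _ => hasDerivAt_negInv γ hγ x
  have hnn : ∀ x ∈ Ioi a, 0 ≤ contactKernel γ x :=
    fun x hx => contactKernel_nonneg γ (ha.trans (le_of_lt hx))
  have hint : IntegrableOn (contactKernel γ) (Ioi a) :=
    integrableOn_Ioi_deriv_of_nonneg hcont hderiv hnn (tendsto_negInv γ)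
  refine ⟨hint, ?_⟩
  rw [integral_Ioi_of_hasDerivAt_of_tendsto hcont hderiv hint (tendsto_negInv γ)]
  ring

/-- `F·k_γ` is integrable on `(a,∞)` for a contact distribution function `F`. -/
lemma integrableOn_mul_contactKernel {F : ℝ → ℝ} (hF : IsContactDF F) (γ : ℝ) (hγ : 0 < γ)
    {a : ℝ} (ha : 0 ≤ a) : IntegrableOn (fun t => F t * contactKernel γ t) (Ioi a) := by
  obtain ⟨hmono, hzero, m, hm⟩ := hF
  have hint := (integral_Ioi_contactKernel γ hγ ha).1
  have hF0 : ∀ t, 0 ≤ t → 0 ≤ F t := fun t ht => by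
    have := hmono ht; rwa [hzero 0 le_rfl] at this
  refine Integrable.mono' (hint.const_mul m) ?_ ?_
  · exact (hmono.measurable.mul (by unfold contactKernel; fun_prop)).aestronglyMeasurable
  · rw [ae_restrict_iff' measurableSet_Ioi]
    refine ae_of_all _ (fun t ht => ?_)
    have ht0 : 0 ≤ t := ha.trans (le_of_lt ht)
    rw [Real.norm_eq_abs, abs_of_nonneg (mul_nonneg (hF0 t ht0) (contactKernel_nonneg γ ht0))]
    exact mul_le_mul_of_nonneg_right (hm t) (contactKernel_nonneg γ ht0)

/-- **A priori local bound from ONE friction** (PROVED): `F(t) ≤ (γ² + t²)·∫₀^∞ F k_γ`. It is what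
makes Helly available without the crux (U): pointwise bounds on `N·Φ_N` from the convergence of the
transforms at a single friction. (Strategist b1 typed the same statement as `aprioriLocalBound`.) -/
theorem apriori_local_bound {F : ℝ → ℝ} (hF : IsContactDF F) {γ : ℝ} (hγ : 0 < γ) {t : ℝ}
    (ht : 0 < t) : F t ≤ (γ ^ 2 + t ^ 2) * contactTransform F γ := by
  have hmono := hF.1
  have hzero := hF.2.1
  have hF0 : ∀ s, 0 ≤ s → 0 ≤ F s := fun s hs => by
    have := hmono hs; rwa [hzero 0 le_rfl] at this
  obtain ⟨hkint, hkval⟩ := integral_Ioi_contactKernel γ hγ ht.le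
  have hpos : 0 < γ ^ 2 + t ^ 2 := by positivity
  have h1 : F t * (γ ^ 2 + t ^ 2)⁻¹ = ∫ s in Ioi t, F t * contactKernel γ s := by
    rw [integral_const_mul, hkval]
  have h2 : ∫ s in Ioi t, F t * contactKernel γ s ≤ ∫ s in Ioi t, F s * contactKernel γ s := by
    refine setIntegral_mono_on (hkint.const_mul (F t)) (integrableOn_mul_contactKernel hF γ hγ ht.le)
      measurableSet_Ioi (fun s hs => ?_)
    exact mul_le_mul_of_nonneg_right (hmono (le_of_lt hs))
      (contactKernel_nonneg γ (ht.le.trans (le_of_lt hs)))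
  have h3 : ∫ s in Ioi t, F s * contactKernel γ s ≤ contactTransform F γ := by
    unfold contactTransform
    refine setIntegral_mono_set (integrableOn_mul_contactKernel hF γ hγ le_rfl) ?_ ?_
    · rw [EventuallyLE, ae_restrict_iff' measurableSet_Ioi]
      exact ae_of_all _ (fun s hs =>
        mul_nonneg (hF0 s (le_of_lt hs)) (contactKernel_nonneg γ (le_of_lt hs)))
    · exact ae_of_all _ (Ioi_subset_Ioi ht.le)
  have key : F t * (γ ^ 2 + t ^ 2)⁻¹ ≤ contactTransform F γ := h1.le.trans (h2.trans h3)
  have := mul_le_mul_of_nonneg_left key hpos.le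
  rw [mul_comm (F t), ← mul_assoc, mul_inv_cancel₀ hpos.ne', one_mul] at this
  exact this

/-! ## 2. The dictionary into the tree's class `N_S` (PROVED modulo `layer_cake`) -/

/-- Stieltjes-function facts for a monotone `G` vanishing on `(-∞,0]`. -/
lemma rightLim_eq_zero_of_neg {G : ℝ → ℝ} (hG0 : ∀ s : ℝ, s ≤ 0 → G s = 0) {y : ℝ}
    (hy : y < 0) : rightLim G y = 0 := by
  refine rightLim_eq_of_tendsto ?_
  refine (tendsto_const_nhds (x := (0 : ℝ))).congr' ?_
  filter_upwards [Ioo_mem_nhdsGT hy] with z hz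
  exact (hG0 z hz.2.le).symm

lemma stieltjes_apply {G : ℝ → ℝ} (hG : Monotone G) (x : ℝ) :
    hG.stieltjesFunction x = rightLim G x :=
  hG.stieltjesFunction_eq x

lemma stieltjes_eq_zero_of_neg {G : ℝ → ℝ} (hG : Monotone G) (hG0 : ∀ s : ℝ, s ≤ 0 → G s = 0)
    {y : ℝ} (hy : y < 0) : hG.stieltjesFunction y = 0 := by
  rw [stieltjes_apply hG, rightLim_eq_zero_of_neg hG0 hy]

lemma leftLim_stieltjes_zero {G : ℝ → ℝ} (hG : Monotone G) (hG0 : ∀ s : ℝ, s ≤ 0 → G s = 0) :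
    leftLim (hG.stieltjesFunction) 0 = 0 := by
  refine leftLim_eq_of_tendsto ?_
  refine (tendsto_const_nhds (x := (0 : ℝ))).congr' ?_
  filter_upwards [self_mem_nhdsWithin] with z hz
  exact (stieltjes_eq_zero_of_neg hG hG0 hz).symm

lemma tendsto_stieltjes_atBot {G : ℝ → ℝ} (hG : Monotone G) (hG0 : ∀ s : ℝ, s ≤ 0 → G s = 0) :
    Tendsto (hG.stieltjesFunction) atBot (𝓝 0) := by
  refine (tendsto_const_nhds (x := (0 : ℝ))).congr' ?_
  filter_upwards [Iio_mem_atBot (0 : ℝ)] with z hz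
  exact (stieltjes_eq_zero_of_neg hG hG0 hz).symm

lemma measure_Iio_zero {G : ℝ → ℝ} (hG : Monotone G) (hG0 : ∀ s : ℝ, s ≤ 0 → G s = 0) :
    hG.stieltjesFunction.measure (Iio 0) = 0 := by
  rw [StieltjesFunction.measure_Iio _ (tendsto_stieltjes_atBot hG hG0), leftLim_stieltjes_zero hG hG0]
  simp

lemma measure_singleton_zero {G : ℝ → ℝ} (hG : Monotone G) (hG0 : ∀ s : ℝ, s ≤ 0 → G s = 0) :
    hG.stieltjesFunction.measure {0} = ENNReal.ofReal (rightLim G 0) := by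
  rw [StieltjesFunction.measure_singleton, leftLim_stieltjes_zero hG hG0, stieltjes_apply hG]
  simp

lemma measure_Ioc_zero {G : ℝ → ℝ} (hG : Monotone G) (b : ℝ) :
    hG.stieltjesFunction.measure (Ioc 0 b) = ENNReal.ofReal (rightLim G b - rightLim G 0) := by
  rw [StieltjesFunction.measure_Ioc, stieltjes_apply hG, stieltjes_apply hG]

/-- The Stieltjes measure of a bounded contact distribution function is finite. -/
lemma isFiniteMeasure_stieltjes {F : ℝ → ℝ} (hF : IsContactDF F) :
    IsFiniteMeasure hF.1.stieltjesFunction.measure := by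
  obtain ⟨hmono, hzero, m, hm⟩ := hF
  set f := hmono.stieltjesFunction with hf
  have hbot : Tendsto f atBot (𝓝 0) := tendsto_stieltjes_atBot hmono hzero
  have hbdd : BddAbove (range f) := by
    refine ⟨m, ?_⟩
    rintro _ ⟨x, rfl⟩
    rw [hf, hmono.stieltjesFunction_eq]
    exact (hmono.rightLim_le (lt_add_one x)).trans (hm _)
  have htop : Tendsto f atTop (𝓝 (⨆ x, f x)) := tendsto_atTop_ciSup f.mono hbdd
  refine ⟨?_⟩
  rw [f.measure_univ hbot htop]
  exact ENNReal.ofReal_lt_top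

/-- The preimage of `(-∞,0)` under `s ↦ s²` is empty, so the squared measure is carried by `[0,∞)`. -/
lemma sqContactMeasure_Iio_zero {F : ℝ → ℝ} (hF : Monotone F) : sqContactMeasure hF (Iio 0) = 0 := by
  unfold sqContactMeasure
  rw [Measure.map_apply (by fun_prop) measurableSet_Iio]
  have : (fun s : ℝ => s ^ 2) ⁻¹' Iio (0 : ℝ) = ∅ := by
    ext s
    simp only [mem_preimage, mem_Iio, mem_empty_iff_false, iff_false, not_lt]
    positivity
  rw [this, measure_empty]

/-- **LAYER CAKE** (the one real-analysis identity left to the prover in §2):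
`∫ (γ²+s²)⁻¹ dμ_F(s) = ∫₀^∞ F(t) k_γ(t) dt`, with integrability. Route: Tonelli on
`ofReal(k_γ t)·1{0 ≤ s ≤ t}` w.r.t. `μ_F ⊗ vol`, the `t`-sections being `μ_F(Icc 0 t) = rightLim F t`
(`measure_Icc` + `leftLim_stieltjes_zero`) and the `s`-sections `∫_{Ici s} k_γ = (γ²+s²)⁻¹`
(`integral_Ioi_contactKernel`); `rightLim F = F` off the countable set of discontinuities
(`Monotone.countable_not_continuousAt`, `rightLim_eq_of_tendsto`). -/
theorem layer_cake {F : ℝ → ℝ} (hF : IsContactDF F) {γ : ℝ} (hγ : 0 < γ) :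
    Integrable (fun s : ℝ => (γ ^ 2 + s ^ 2)⁻¹) hF.1.stieltjesFunction.measure ∧
    ∫ s, (γ ^ 2 + s ^ 2)⁻¹ ∂(hF.1.stieltjesFunction.measure) = contactTransform F γ := by
  sorry

/-- **THE DICTIONARY (first lemma; PROVED from `layer_cake`).** For a contact distribution function
`F`, the Cauchy–Stieltjes extension of its contact transform lies in the tree's Stieltjes class `N_S`
with data `(0, ν_F)`, `ν_F = sqContactMeasure`, and its value at `z = -γ²` is the contact transform. -/
theorem hasStieltjesRepresentation_contactCS {F : ℝ → ℝ} (hF : IsContactDF F) :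
    HasStieltjesRepresentation (contactCS hF.1) 0 (sqContactMeasure hF.1) ∧
      ∀ γ : ℝ, 0 < γ → contactCS hF.1 (-((γ ^ 2 : ℝ) : ℂ)) = (contactTransform F γ : ℂ) := by
  haveI := isFiniteMeasure_stieltjes hF
  have hmeas : Measurable fun s : ℝ => s ^ 2 := by fun_prop
  haveI : IsFiniteMeasure (sqContactMeasure hF.1) := by
    unfold sqContactMeasure; infer_instance
  refine ⟨⟨le_rfl, sqContactMeasure_Iio_zero hF.1, ?_, fun z _ => by simp [contactCS]⟩,
    fun γ hγ => ?_⟩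
  · -- `∫ (1+t)⁻¹ dσ ≤ σ(ℝ) < ∞` on the carrier `t ≥ 0`
    have hae : ∀ᵐ t ∂(sqContactMeasure hF.1), (0 : ℝ) ≤ t := by
      rw [ae_iff]
      have hset : {a : ℝ | ¬0 ≤ a} = Iio 0 := by ext a; simp
      rw [hset]; exact sqContactMeasure_Iio_zero hF.1
    calc ∫⁻ t, ENNReal.ofReal ((1 + t)⁻¹) ∂(sqContactMeasure hF.1)
        ≤ ∫⁻ _, 1 ∂(sqContactMeasure hF.1) := by
          refine lintegral_mono_ae ?_
          filter_upwards [hae] with t ht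
          rw [← ENNReal.ofReal_one]
          exact ENNReal.ofReal_le_ofReal (inv_le_one_of_one_le₀ (by linarith))
      _ = sqContactMeasure hF.1 univ := by simp
      _ < ⊤ := measure_lt_top _ _
  · -- the value at `z = -γ²`: cast to a real integral, change variables `λ = s²`, layer cake
    obtain ⟨-, hval⟩ := layer_cake hF hγ
    unfold contactCS
    have hcongr : (fun t : ℝ => ((t : ℂ) - (-((γ ^ 2 : ℝ) : ℂ)))⁻¹) =
        fun t : ℝ => (((fun u : ℝ => (γ ^ 2 + u)⁻¹) t : ℝ) : ℂ) := by
      funext t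
      simp only [Complex.ofReal_inv]
      push_cast
      ring
    rw [hcongr, integral_complex_ofReal]
    congr 1
    unfold sqContactMeasure
    rw [integral_map hmeas.aemeasurable]
    · simpa [add_comm] using hval
    · exact (Measurable.aestronglyMeasurable (by fun_prop))

/-! ## 3. Helly with local bounds (PROVED over the tree) -/

/-- **Helly with local bounds** (PROVED over the tree's diagonal extraction at the rationals
`Literature.Analysis.FunctionSpaces.exists_strictMono_forall_tendsto_real`; the limit function is
`G t = sup {l q : q < t, q ∈ ℚ}` with `l q` the rational limits, and convergence at continuity points
of `G` is the squeeze through rationals): from any subsequence `ψ` of a family of monotone functions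
vanishing on `(-∞,0]` and bounded at each point uniformly in `N`, extract a further subsequence
converging, at every continuity point `t > 0` of a monotone limit `G` vanishing on `(-∞,0]`, to `G t`.
(`StrictMono ψ` is not used by the extraction; kept for the caller's bookkeeping.) -/
theorem helly_local (F : ℕ → ℝ → ℝ) (hF : ∀ N, Monotone (F N))
    (hF0 : ∀ N (s : ℝ), s ≤ 0 → F N s = 0) (hbd : ∀ t : ℝ, ∃ C : ℝ, ∀ N, F N t ≤ C)
    (ψ : ℕ → ℕ) (_hψ : StrictMono ψ) :
    ∃ φ : ℕ → ℕ, StrictMono φ ∧ ∃ G : ℝ → ℝ, Monotone G ∧ (∀ s : ℝ, s ≤ 0 → G s = 0) ∧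
      ∀ t : ℝ, 0 < t → ContinuousAt G t →
        Tendsto (fun k => F (ψ (φ k)) t) atTop (𝓝 (G t)) := by
  have hFnn : ∀ N t, 0 ≤ F N t := by
    intro N t
    rcases le_or_gt t 0 with ht | ht
    · rw [hF0 N t ht]
    · have h := hF N ht.le
      rwa [hF0 N 0 le_rfl] at h
  obtain ⟨φ, hφ, hconv⟩ :=
    Literature.Analysis.FunctionSpaces.exists_strictMono_forall_tendsto_real
      (fun n (q : ℚ) => F (ψ n) q) (fun q => by
        obtain ⟨C, hC⟩ := hbd q
        refine ⟨|C|, fun n => ?_⟩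
        show |F (ψ n) q| ≤ |C|
        rw [abs_of_nonneg (hFnn _ _)]
        exact (hC _).trans (le_abs_self C))
  choose l hl using hconv
  have hlmono : ∀ q q' : ℚ, q ≤ q' → l q ≤ l q' := fun q q' hqq' =>
    le_of_tendsto_of_tendsto (hl q) (hl q')
      (Eventually.of_forall fun n => hF _ (by exact_mod_cast hqq'))
  let S : ℝ → Set ℝ := fun t => l '' {q : ℚ | (q : ℝ) < t}
  have hSne : ∀ t, 0 < t → (S t).Nonempty := fun t ht =>
    ⟨l 0, 0, by simpa using ht, rfl⟩
  have hSbdd : ∀ t, BddAbove (S t) := fun t => by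
    obtain ⟨q', hq'⟩ := exists_rat_gt t
    refine ⟨l q', ?_⟩
    rintro _ ⟨q, hq, rfl⟩
    exact hlmono q q' (by exact_mod_cast (lt_trans hq hq').le)
  have hSmono : ∀ t t', t ≤ t' → S t ⊆ S t' := fun t t' htt' => by
    rintro _ ⟨q, hq, rfl⟩
    exact ⟨q, lt_of_lt_of_le hq htt', rfl⟩
  let G : ℝ → ℝ := fun t => if t ≤ 0 then 0 else sSup (S t)
  have hGpos : ∀ t, 0 < t → G t = sSup (S t) := fun t ht => if_neg (not_le.2 ht)
  have hGnp : ∀ t, t ≤ 0 → G t = 0 := fun t ht => if_pos ht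
  have hl0 : 0 ≤ l 0 := ge_of_tendsto (hl 0) (Eventually.of_forall fun n => hFnn _ _)
  have hGnn : ∀ t, 0 ≤ G t := fun t => by
    rcases le_or_gt t 0 with ht | ht
    · rw [hGnp t ht]
    · rw [hGpos t ht]
      exact hl0.trans (le_csSup (hSbdd t) ⟨0, by simpa using ht, rfl⟩)
  have hGmono : Monotone G := by
    intro t t' htt'
    rcases le_or_gt t 0 with ht | ht
    · rw [hGnp t ht]; exact hGnn t'
    · rw [hGpos t ht, hGpos t' (ht.trans_le htt')]
      exact csSup_le_csSup (hSbdd t') (hSne t ht) (hSmono t t' htt')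
  refine ⟨φ, hφ, G, hGmono, hGnp, fun t ht hcont => ?_⟩
  rw [hGpos t ht]
  refine tendsto_order.2 ⟨fun x hx => ?_, fun x hx => ?_⟩
  · obtain ⟨_, ⟨q, hq, rfl⟩, hxq⟩ := exists_lt_of_lt_csSup (hSne t ht) hx
    filter_upwards [(hl q).eventually (lt_mem_nhds hxq)] with n hn
    exact hn.trans_le (hF _ hq.le)
  · have hx' : G t < x := by rwa [hGpos t ht]
    have hev : ∀ᶠ y in 𝓝 t, G y < x := hcont.eventually (gt_mem_nhds hx')
    obtain ⟨lo, hi, ⟨hlo, hhi⟩, hsub⟩ := mem_nhds_iff_exists_Ioo_subset.1 hev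
    obtain ⟨q', htq', hq'hi⟩ := exists_rat_btwn hhi
    have hmid : ((q' : ℝ) + hi) / 2 ∈ Ioo lo hi := ⟨by linarith, by linarith⟩
    have hGmid : G (((q' : ℝ) + hi) / 2) < x := hsub hmid
    have hmidpos : 0 < ((q' : ℝ) + hi) / 2 := by linarith
    rw [hGpos _ hmidpos] at hGmid
    have hlq' : l q' ≤ sSup (S (((q' : ℝ) + hi) / 2)) :=
      le_csSup (hSbdd _) ⟨q', by show (q' : ℝ) < ((q' : ℝ) + hi) / 2; linarith, rfl⟩
    have hlx : l q' < x := hlq'.trans_lt hGmid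
    filter_upwards [(hl q').eventually (gt_mem_nhds hlx)] with n hn
    exact (hF _ htq'.le).trans_lt hn

/-! ## 4. Escaped mass = Stieltjes constant (the remaining M-sized sorry) -/

/-- **ESCAPED MASS IS THE STIELTJES CONSTANT.** Along a Helly subsequence `φ` with pointwise limit
`G`, the limit `L(γ)` of the contact transforms is represented by Stieltjes data `(e, ν_G)` in `N_S`:
`L(γ) = e + ∫ dν_G(λ)/(λ + γ²)` for ALL `γ > 0`, where `e = L(γ) - ∫₀^∞ G k_γ ≥ 0` (Fatou) is the
contact mass escaped to `s = ∞` — independent of `γ` because `k_γ/k_γ' → 1` at `∞` — and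
`q(z) := e + ∫ dν_G(λ)/(λ - z)` is its extension. (`∫ dν_G/(1+λ) < ∞` from `apriori_local_bound` +
Fatou; the `γ`-independence argument is the pattern of `StieltjesDataUnique.tendsto_apply_neg_atTop`.)
NOTE FOR THE PROVER: the limit `G` is monotone but possibly UNBOUNDED, so this lemma needs the layer
cake in its unconditional `lintegral` form — `∫⁻ ofReal((γ²+s²)⁻¹) dμ_G = ∫⁻_{t>0} ofReal(G t · k_γ t)`
for every monotone `G` vanishing on `(-∞,0]` (same Tonelli argument as `layer_cake`, no finiteness
needed); prove that form once and derive `layer_cake` (bounded case) from it. Steps: (i) Fatou gives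
`∫ G k_γ ≤ L γ`; (ii) bounded convergence on `(0,R]` (pointwise bound at `R` + monotonicity);
(iii) tails `τ(R,γ) = L γ − ∫_{(0,R]} G k_γ ↓ e(γ) ≥ 0`; (iv) `k_γ'/k_γ → 1` at `∞` gives
`e(γ') ≤ (1+ε) e(γ)` for all `ε`, hence `e` is constant; (v) `q z := e + ∫ (t - z)⁻¹ dν_G` has
Stieltjes data `(e, ν_G)` (carrier and finiteness of `∫ dν_G/(1+λ) = ∫ G k_1 ≤ L 1` as in §2). -/
theorem limitData_of_subseq (F : ℕ → ℝ → ℝ) (hF : ∀ N, IsContactDF (F N)) (L : ℝ → ℝ)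
    (hL : ∀ γ : ℝ, 0 < γ → Tendsto (fun N => contactTransform (F N) γ) atTop (𝓝 (L γ)))
    (φ : ℕ → ℕ) (hφ : StrictMono φ) {G : ℝ → ℝ} (hG : Monotone G)
    (hG0 : ∀ s : ℝ, s ≤ 0 → G s = 0)
    (hlim : ∀ t : ℝ, 0 < t → ContinuousAt G t → Tendsto (fun k => F (φ k) t) atTop (𝓝 (G t))) :
    ∃ e : ℝ, 0 ≤ e ∧ ∃ q : ℂ → ℂ, HasStieltjesRepresentation q e (sqContactMeasure hG) ∧
      ∀ γ : ℝ, 0 < γ → q (-((γ ^ 2 : ℝ) : ℂ)) = (L γ : ℂ) := by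
  sorry

/-! ## 5. Uniqueness of the limit data (PROVED over the tree) -/

/-- **UNIQUENESS OF THE LIMIT DATA — in the tree.** Two Stieltjes data sets whose functions agree at
the points `-γ²`, `γ > 0` (i.e. match the same limit `L`), coincide: same escaped mass AND same
measure. Proof: `eqOn_of_hasStieltjesRepresentation_of_eqOn_neg` (StieltjesHolomorphic) and
`stieltjes_data_unique` (StieltjesInversion: Stieltjes–Perron + `b = lim_{s→∞} q(-s)`). -/
theorem limitData_unique {q₁ q₂ : ℂ → ℂ} {e₁ e₂ : ℝ} {ν₁ ν₂ : Measure ℝ}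
    (h₁ : HasStieltjesRepresentation q₁ e₁ ν₁) (h₂ : HasStieltjesRepresentation q₂ e₂ ν₂)
    (hL : ∀ γ : ℝ, 0 < γ → q₁ (-((γ ^ 2 : ℝ) : ℂ)) = q₂ (-((γ ^ 2 : ℝ) : ℂ))) :
    e₁ = e₂ ∧ ν₁ = ν₂ := by
  have h : ∀ s : ℝ, 0 < s → q₁ (-(s : ℂ)) = q₂ (-(s : ℂ)) := fun s hs => by
    have h' := hL (Real.sqrt s) (Real.sqrt_pos.2 hs)
    rwa [Real.sq_sqrt hs.le] at h'
  have hEq := eqOn_of_hasStieltjesRepresentation_of_eqOn_neg h₁ h₂ h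
  have h₂' : HasStieltjesRepresentation q₁ e₂ ν₂ :=
    ⟨h₂.1, h₂.2.1, h₂.2.2.1, fun z hz => (hEq hz).trans (h₂.2.2.2 z hz)⟩
  exact stieltjes_data_unique h₁ h₂'

/-! ## 6. Equal data ⇒ equal limits at continuity points (PROVED) -/

/-- The squared measure of `{0}` is the atom `rightLim G 0`. -/
lemma sq_singleton {G : ℝ → ℝ} (hG : Monotone G) (hG0 : ∀ s : ℝ, s ≤ 0 → G s = 0) :
    sqContactMeasure hG {0} = ENNReal.ofReal (rightLim G 0) := by
  unfold sqContactMeasure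
  rw [Measure.map_apply (by fun_prop) (measurableSet_singleton 0)]
  have hpre : (fun s : ℝ => s ^ 2) ⁻¹' ({0} : Set ℝ) = {0} := by
    ext s; simp
  rw [hpre, measure_singleton_zero hG hG0]

/-- The squared measure of `(0, b²]` is `rightLim G b − rightLim G 0` (`b > 0`). -/
lemma sq_Ioc {G : ℝ → ℝ} (hG : Monotone G) (hG0 : ∀ s : ℝ, s ≤ 0 → G s = 0) {b : ℝ}
    (hb : 0 < b) :
    sqContactMeasure hG (Ioc 0 (b ^ 2)) = ENNReal.ofReal (rightLim G b - rightLim G 0) := by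
  unfold sqContactMeasure
  rw [Measure.map_apply (by fun_prop) measurableSet_Ioc]
  set P : Set ℝ := (fun s : ℝ => s ^ 2) ⁻¹' Ioc 0 (b ^ 2) with hP
  have hsub1 : Ioc 0 b ⊆ P := by
    intro s hs
    refine ⟨pow_pos hs.1 2, ?_⟩
    exact pow_le_pow_left₀ hs.1.le hs.2 2
  have hsub2 : P ⊆ Ioc 0 b ∪ Iio 0 := by
    intro s hs
    rcases lt_or_ge s 0 with hs0 | hs0
    · exact Or.inr hs0
    · refine Or.inl ⟨?_, ?_⟩
      · rcases hs0.eq_or_lt with h0 | h0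
        · exfalso; have := hs.1; rw [← h0] at this; simp at this
        · exact h0
      · exact le_of_pow_le_pow_left₀ two_ne_zero hb.le hs.2
  apply le_antisymm
  · calc hG.stieltjesFunction.measure P
        ≤ hG.stieltjesFunction.measure (Ioc 0 b ∪ Iio 0) := measure_mono hsub2
      _ ≤ hG.stieltjesFunction.measure (Ioc 0 b) + hG.stieltjesFunction.measure (Iio 0) :=
          measure_union_le _ _
      _ = ENNReal.ofReal (rightLim G b - rightLim G 0) := by
          rw [measure_Iio_zero hG hG0, add_zero, measure_Ioc_zero hG]
  · calc ENNReal.ofReal (rightLim G b - rightLim G 0)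
        = hG.stieltjesFunction.measure (Ioc 0 b) := (measure_Ioc_zero hG b).symm
      _ ≤ hG.stieltjesFunction.measure P := measure_mono hsub1

/-- Equal squared contact measures ⇒ equal right limits on `(0, ∞)`. -/
lemma rightLim_eq_of_sqContactMeasure_eq {G₁ G₂ : ℝ → ℝ} (h₁ : Monotone G₁) (h₂ : Monotone G₂)
    (h₁0 : ∀ s : ℝ, s ≤ 0 → G₁ s = 0) (h₂0 : ∀ s : ℝ, s ≤ 0 → G₂ s = 0)
    (h : sqContactMeasure h₁ = sqContactMeasure h₂) {b : ℝ} (hb : 0 < b) :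
    rightLim G₁ b = rightLim G₂ b := by
  have hnn₁ : ∀ x, 0 ≤ rightLim G₁ x := fun x => by
    have := h₁.le_rightLim (le_refl x)
    rcases le_or_gt x 0 with hx | hx
    · rw [h₁0 x hx] at this; exact this
    · exact le_trans (by rw [h₁0 0 le_rfl]) ((h₁ hx.le).trans this)
  have hnn₂ : ∀ x, 0 ≤ rightLim G₂ x := fun x => by
    have := h₂.le_rightLim (le_refl x)
    rcases le_or_gt x 0 with hx | hx
    · rw [h₂0 x hx] at this; exact this
    · exact le_trans (by rw [h₂0 0 le_rfl]) ((h₂ hx.le).trans this)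
  have h0 : rightLim G₁ 0 = rightLim G₂ 0 := by
    have e : sqContactMeasure h₁ {0} = sqContactMeasure h₂ {0} := by rw [h]
    rw [sq_singleton h₁ h₁0, sq_singleton h₂ h₂0] at e
    exact (ENNReal.ofReal_eq_ofReal_iff (hnn₁ 0) (hnn₂ 0)).1 e
  have hinc : rightLim G₁ b - rightLim G₁ 0 = rightLim G₂ b - rightLim G₂ 0 := by
    have e : sqContactMeasure h₁ (Ioc 0 (b ^ 2)) = sqContactMeasure h₂ (Ioc 0 (b ^ 2)) := by rw [h]
    rw [sq_Ioc h₁ h₁0 hb, sq_Ioc h₂ h₂0 hb] at e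
    exact (ENNReal.ofReal_eq_ofReal_iff (sub_nonneg.2 (h₁.rightLim hb.le))
      (sub_nonneg.2 (h₂.rightLim hb.le))).1 e
  linarith

/-- **Equal squared contact measures ⇒ equal values at continuity points** (PROVED): if the squared
measures of `G₁`, `G₂` coincide then at every continuity point `t > 0` of `G₁`, `G₂` is continuous
too and `G₁ t = G₂ t` (their `rightLim`s agree on `(0,∞)`; squeeze). -/
theorem eq_at_continuity_of_sqContactMeasure_eq {G₁ G₂ : ℝ → ℝ} (h₁ : Monotone G₁)
    (h₂ : Monotone G₂) (h₁0 : ∀ s : ℝ, s ≤ 0 → G₁ s = 0) (h₂0 : ∀ s : ℝ, s ≤ 0 → G₂ s = 0)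
    (h : sqContactMeasure h₁ = sqContactMeasure h₂) {t : ℝ} (ht : 0 < t)
    (hc₁ : ContinuousAt G₁ t) : ContinuousAt G₂ t ∧ G₁ t = G₂ t := by
  have hR : ∀ s, 0 < s → rightLim G₂ s = rightLim G₁ s := fun s hs =>
    (rightLim_eq_of_sqContactMeasure_eq h₁ h₂ h₁0 h₂0 h hs).symm
  have hT : Tendsto G₂ (𝓝 t) (𝓝 (G₁ t)) := by
    refine tendsto_order.2 ⟨fun x hx => ?_, fun x hx => ?_⟩
    · have hev : ∀ᶠ y in 𝓝 t, x < G₁ y := hc₁.eventually (lt_mem_nhds hx)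
      obtain ⟨lo, hi, ⟨hlo, hhi⟩, hsub⟩ := mem_nhds_iff_exists_Ioo_subset.1 hev
      set s : ℝ := max ((lo + t) / 2) (t / 2) with hs
      have hs_pos : 0 < s := lt_of_lt_of_le (by linarith) (le_max_right _ _)
      have hs_lt : s < t := max_lt (by linarith) (by linarith)
      have hs_mem : s ∈ Ioo lo hi :=
        ⟨lt_of_lt_of_le (by linarith) (le_max_left _ _), hs_lt.trans hhi⟩
      have hxs : x < G₁ s := hsub hs_mem
      filter_upwards [Ioi_mem_nhds hs_lt] with y hy
      calc x < G₁ s := hxs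
        _ ≤ rightLim G₁ s := h₁.le_rightLim le_rfl
        _ = rightLim G₂ s := (hR s hs_pos).symm
        _ ≤ G₂ y := h₂.rightLim_le hy
    · have hev : ∀ᶠ y in 𝓝 t, G₁ y < x := hc₁.eventually (gt_mem_nhds hx)
      obtain ⟨lo, hi, ⟨hlo, hhi⟩, hsub⟩ := mem_nhds_iff_exists_Ioo_subset.1 hev
      set s' : ℝ := (t + hi) / 2 with hs'
      have hs'_gt : t < s' := by linarith
      have hs'_mem : s' ∈ Ioo lo hi := ⟨by linarith, by linarith⟩
      have hxs' : G₁ s' < x := hsub hs'_mem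
      filter_upwards [Ioo_mem_nhds ht hs'_gt] with y hy
      calc G₂ y ≤ rightLim G₂ y := h₂.le_rightLim le_rfl
        _ = rightLim G₁ y := hR y hy.1
        _ ≤ G₁ s' := h₁.rightLim_le hy.2
        _ < x := hxs'
  have hle : G₂ t ≤ G₁ t :=
    calc G₂ t ≤ rightLim G₂ t := h₂.le_rightLim le_rfl
      _ = rightLim G₁ t := hR t ht
      _ = G₁ t := rightLim_eq_of_tendsto (hc₁.tendsto.mono_left nhdsWithin_le_nhds)
  have hge : G₁ t ≤ G₂ t := by
    have hlim : Tendsto G₁ (𝓝[<] t) (𝓝 (G₁ t)) := hc₁.tendsto.mono_left nhdsWithin_le_nhds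
    refine le_of_tendsto hlim ?_
    filter_upwards [Ioo_mem_nhdsLT ht] with s hs
    calc G₁ s ≤ rightLim G₁ s := h₁.le_rightLim le_rfl
      _ = rightLim G₂ s := (hR s hs.1).symm
      _ ≤ G₂ t := h₂.rightLim_le hs.2
  have heq : G₁ t = G₂ t := le_antisymm hge hle
  refine ⟨?_, heq⟩
  show Tendsto G₂ (𝓝 t) (𝓝 (G₂ t))
  rw [← heq]
  exact hT

/-! ## Target and by-products -/

/-- The analysis child of the crux, VERBATIM the registered stub `stub_stieltjesContinuity`
(lines `birth`, `escape-import`) and child 1 of SPLIT-PROPOSAL.md. §§1–6 + the sub-subsequence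
principle `Filter.tendsto_of_subseq_tendsto` prove it (take `M := rightLim G` for one Helly limit `G`
along `id`; for an arbitrary subsequence `ψ`, `helly_local` + `limitData_of_subseq` +
`limitData_unique` + `eq_at_continuity_of_sqContactMeasure_eq` identify the further limit with `M`
at the continuity points of `M`). -/
def StieltjesContinuity : Prop :=
  ∀ F : ℕ → ℝ → ℝ, (∀ N : ℕ, Monotone (F N) ∧ (∀ s : ℝ, s ≤ 0 → F N s = 0) ∧
    (∃ m : ℝ, ∀ s : ℝ, F N s ≤ m)) →
    (∀ γ : ℝ, 0 < γ → ∃ L : ℝ, Filter.Tendsto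
      (fun N : ℕ => ∫ t in Set.Ioi (0 : ℝ), F N t * (2 * t / (γ ^ 2 + t ^ 2) ^ 2))
      Filter.atTop (nhds L)) →
    ∃ M : ℝ → ℝ, Monotone M ∧ ∀ t : ℝ, 0 < t → ContinuousAt M t →
      Filter.Tendsto (fun N : ℕ => F N t) Filter.atTop (nhds (M t))

/-- Sanity: the transform inside `StieltjesContinuity` is `contactTransform` (definitional). -/
example (F : ℝ → ℝ) (γ : ℝ) :
    (∫ t in Set.Ioi (0 : ℝ), F t * (2 * t / (γ ^ 2 + t ^ 2) ^ 2)) = contactTransform F γ := rfl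

/-- ROUTE-LEVEL BY-PRODUCT of the dictionary (typed remark for tenure, not an item): with Stieltjes
data the UV slack of `closes` is one scalar. Given the representation hypothesis of the crux and
bounded response at each friction, along any subsequence the scaled transforms `N·contactTransform Φ_N γ`
converge to `e + ∫ dν(λ)/(λ+γ²)` where `ν` is fixed by (M) but the escaped constant `e ≥ 0` may depend
on the subsequence; (U) forces `e = 0`. So `closes` needs from (U) only "the escaped constant does not
oscillate" — e.g. 12238 at ONE friction, or UV-tightness `lim_R limsup_N N·∫_R^∞ Φ_N k_γ = 0`. -/
def UVTightness (Φ : ℕ → ℝ → ℝ) (γ : ℝ) : Prop :=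
  ∀ ε : ℝ, 0 < ε → ∃ R : ℝ, ∀ᶠ N : ℕ in atTop,
    (N : ℝ) * ∫ t in Set.Ioi R, Φ N t * contactKernel γ t ≤ ε

end Summit.AtomisticToContinuum.FouriersLaw.Cruxes.ContactMeasureLimit.IdeatorOne

end
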